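import Literature.RepresentationTheory.FiniteGroups.GL2ModularPrincipalSeriesLatticeReduction
import Literature.RepresentationTheory.FiniteGroups.GL2ModularPrincipalSeriesJordanHolder
import Literature.RepresentationTheory.IrreducibleTwistTransport
import HarnessLib

/-!
# The socle of `L₀/ϖL₀` over the group ring: simplicity, uniseriality, and multiplicity one

Topic `Literature/RepresentationTheory/FiniteGroups`, namespace `Literature.RepresentationTheory.FiniteGroups.GL2`.
One definition (`modelSocle`) + THEOREMS; no named fact, no instance, no notation, no `sorry`.

For `GL₂(𝔽_p)`, `R ↠ k` onto a field of characteristic `p` with `ker = (ϖ)`, `χ₁ χ₂ : 𝔽_pˣ → Rˣ` with reductions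
`χ̄₁ ≠ χ̄₂ = χ̄₁ε^r` (`r + s = p − 1`) and a model `ρ₀ ≃ Fun_R(Ind(χ₁ ⊗ χ₂))` of the standard lattice `L₀`, the
reduction `L₀/ϖL₀ ≅ 𝓑(χ̄₁, χ̄₂)` (previous file) inherits the structure of the mod-`p` principal series
[EmertonGeeSavitt2015, §3.2; tree `GL2ModularPrincipalSeriesSocle` / `LengthTwo` / `JordanHolder`], now OVER THE
GROUP RING `R[GL₂(𝔽_p)]` — exactly the hypotheses `hsocL'`, `hmult` of the lattice lemma
`Literature.RepresentationTheory.exists_smul_eq_smul_of_socle` [EmertonGeeSavitt2015, Lemma 4.1.1] for `L' = L₀`: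

* `modelSocle` — the socle submodule `S` (preimage of `Sym^r ⊗ χ̄₁∘det`), `modelSubmoduleOrderIso_modelSocle`,
  `mem_modelSocle_iff`, `modelSocle_ne_bot`;
* **`modelSocle_le_of_ne_bot`** — `S` lies in every nonzero submodule (socle, simple);
* **`eq_bot_or_eq_modelSocle_or_eq_top`** — uniserial of length two;
* **`not_socle_embeds_quotient`**, **`not_socle_embeds_twice`** — MULTIPLICITY ONE: `S` does not embed
  `R[GL₂(𝔽_p)]`-linearly into a submodule `N` and into `(L₀/ϖL₀)/N` at the same time.  Proof of the hard case
  `N = S`: the intertwining operator `T` in coordinates (`coordIntertwining`, `coordIntertwiningLinear`) kills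
  exactly `S` (`ker_coordIntertwiningLinear_comp`), so `S ↪ (L₀/ϖL₀)/S ↪ im T` would be an injective intertwining
  map between the irreducible, NON-isomorphic Jordan–Hölder factors `Sym^r ⊗ χ̄₁∘det` and `Sym^s ⊗ χ̄₂∘det`
  (`isEmpty_equiv_socle_cosocle`), absurd.
-/

noncomputable section

namespace Literature.RepresentationTheory.FiniteGroups

namespace GL2

open Function Pointwise
open Literature.NumberTheory.Automorphic (TwistedQuotient.resScalars TwistedQuotient.resScalars_apply)

section Socle

variable (p : ℕ) [Fact p.Prime] {R : Type} [CommRing R] {k : Type} [Field k] [CharP k p] [Algebra R k]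
  (χ₁ χ₂ : (ZMod p)ˣ →* Rˣ) {V₀ : Type} [AddCommGroup V₀] [Module R V₀]
  {ρ₀ : Representation R (GL (Fin 2) (ZMod p)) V₀} (e₀ : ρ₀.Equiv (principalSeriesRep (ZMod p) χ₁ χ₂)) {r s : ℕ}

/-- **The socle submodule of `L₀/ϖL₀`** over the group ring: the preimage under the dictionary of the socle
`Sym^r ⊗ χ̄₁∘det ⊂ Fun_k(Ind(χ̄₁ ⊗ χ̄₂))` (`χ̄₂ = χ̄₁ ε^r`). [cite: EmertonGeeSavitt2015, §3.2] -/
def modelSocle {ϖ : R} (hker : ∀ a : R, algebraMap R k a = 0 ↔ ϖ ∣ a) (hsurj : Surjective (algebraMap R k))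
    (hχ : ∀ a : (ZMod p)ˣ, (reduceChar k χ₂ a : k) = (reduceChar k χ₁ a : k) * ZMod.castHom (dvd_refl p) k a ^ r) :
    Submodule (MonoidAlgebra R (GL (Fin 2) (ZMod p)))
      (↥(⊤ : Submodule (MonoidAlgebra R (GL (Fin 2) (ZMod p))) ρ₀.asModule) ⧸
        (ϖ • (⊤ : Submodule (MonoidAlgebra R (GL (Fin 2) (ZMod p))) ρ₀.asModule)).comap
          (⊤ : Submodule (MonoidAlgebra R (GL (Fin 2) (ZMod p))) ρ₀.asModule).subtype) :=
  (modelSubmoduleOrderIso χ₁ χ₂ e₀ hker hsurj).symm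
    (symPowSubrep (ZMod.castHom (dvd_refl p) k) (reduceChar k χ₁) (reduceChar k χ₂) r hχ)

/-- The dictionary sends the socle submodule to the socle subrepresentation. [cite: EmertonGeeSavitt2015, §3.2] -/
theorem modelSubmoduleOrderIso_modelSocle {ϖ : R} (hker : ∀ a : R, algebraMap R k a = 0 ↔ ϖ ∣ a)
    (hsurj : Surjective (algebraMap R k))
    (hχ : ∀ a : (ZMod p)ˣ, (reduceChar k χ₂ a : k) = (reduceChar k χ₁ a : k) * ZMod.castHom (dvd_refl p) k a ^ r) :
    modelSubmoduleOrderIso χ₁ χ₂ e₀ hker hsurj (modelSocle p χ₁ χ₂ e₀ hker hsurj hχ) =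
      symPowSubrep (ZMod.castHom (dvd_refl p) k) (reduceChar k χ₁) (reduceChar k χ₂) r hχ :=
  OrderIso.apply_symm_apply _ _

/-- **Socle**: the socle submodule lies in every nonzero submodule of `L₀/ϖL₀` (`χ̄₁ ≠ χ̄₂ = χ̄₁ε^r`, `r < p`). [cite: EmertonGeeSavitt2015, §3.2] -/
theorem modelSocle_le_of_ne_bot {ϖ : R} (hker : ∀ a : R, algebraMap R k a = 0 ↔ ϖ ∣ a)
    (hsurj : Surjective (algebraMap R k)) (hχne : reduceChar k χ₁ ≠ reduceChar k χ₂)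
    (hχ : ∀ a : (ZMod p)ˣ, (reduceChar k χ₂ a : k) = (reduceChar k χ₁ a : k) * ZMod.castHom (dvd_refl p) k a ^ r)
    (hr : r < p)
    (N : Submodule (MonoidAlgebra R (GL (Fin 2) (ZMod p)))
      (↥(⊤ : Submodule (MonoidAlgebra R (GL (Fin 2) (ZMod p))) ρ₀.asModule) ⧸
        (ϖ • (⊤ : Submodule (MonoidAlgebra R (GL (Fin 2) (ZMod p))) ρ₀.asModule)).comap
          (⊤ : Submodule (MonoidAlgebra R (GL (Fin 2) (ZMod p))) ρ₀.asModule).subtype))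
    (hN : N ≠ ⊥) : modelSocle p χ₁ χ₂ e₀ hker hsurj hχ ≤ N := by
  set Φ := modelSubmoduleOrderIso χ₁ χ₂ e₀ hker hsurj with hΦ
  have hΦN : Φ N ≠ ⊥ := by
    intro h
    apply hN
    apply Φ.injective
    rw [h, OrderIso.map_bot]
  have hle := symPowSubrep_le_of_ne_bot p hχne hχ hr (Φ N) hΦN
  have := Φ.symm.monotone hle
  rwa [OrderIso.symm_apply_apply] at this

/-- The socle submodule is nonzero. [cite: EmertonGeeSavitt2015, §3.2] -/
theorem modelSocle_ne_bot {ϖ : R} (hker : ∀ a : R, algebraMap R k a = 0 ↔ ϖ ∣ a)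
    (hsurj : Surjective (algebraMap R k))
    (hχ : ∀ a : (ZMod p)ˣ, (reduceChar k χ₂ a : k) = (reduceChar k χ₁ a : k) * ZMod.castHom (dvd_refl p) k a ^ r)
    (hr : r < p) : modelSocle p χ₁ χ₂ e₀ hker hsurj hχ ≠ ⊥ := by
  intro h
  have hr' : r < Fintype.card (ZMod p) := by rwa [ZMod.card]
  apply symPowSubrep_ne_bot hχ hr'
  rw [← modelSubmoduleOrderIso_modelSocle p χ₁ χ₂ e₀ hker hsurj hχ, h, OrderIso.map_bot]

/-- **Uniserial of length two**: every submodule of `L₀/ϖL₀` over the group ring is `0`, the socle, or everything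
(`χ̄₁ ≠ χ̄₂ = χ̄₁ε^r`, `r + s = p − 1`). [cite: EmertonGeeSavitt2015, §3.2] -/
theorem eq_bot_or_eq_modelSocle_or_eq_top {ϖ : R} (hker : ∀ a : R, algebraMap R k a = 0 ↔ ϖ ∣ a)
    (hsurj : Surjective (algebraMap R k)) (hχne : reduceChar k χ₁ ≠ reduceChar k χ₂)
    (hχ : ∀ a : (ZMod p)ˣ, (reduceChar k χ₂ a : k) = (reduceChar k χ₁ a : k) * ZMod.castHom (dvd_refl p) k a ^ r)
    (hrs : r + s = p - 1)
    (N : Submodule (MonoidAlgebra R (GL (Fin 2) (ZMod p)))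
      (↥(⊤ : Submodule (MonoidAlgebra R (GL (Fin 2) (ZMod p))) ρ₀.asModule) ⧸
        (ϖ • (⊤ : Submodule (MonoidAlgebra R (GL (Fin 2) (ZMod p))) ρ₀.asModule)).comap
          (⊤ : Submodule (MonoidAlgebra R (GL (Fin 2) (ZMod p))) ρ₀.asModule).subtype)) :
    N = ⊥ ∨ N = modelSocle p χ₁ χ₂ e₀ hker hsurj hχ ∨ N = ⊤ := by
  set Φ := modelSubmoduleOrderIso χ₁ χ₂ e₀ hker hsurj with hΦ
  rcases eq_bot_or_eq_socle_or_eq_top p hχne hχ hrs (Φ N) with h | h | h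
  · left
    apply Φ.injective
    rw [h, OrderIso.map_bot]
  · right; left
    apply Φ.injective
    rw [h, hΦ, modelSubmoduleOrderIso_modelSocle]
  · right; right
    apply Φ.injective
    rw [h, OrderIso.map_top]

/-! ### Multiplicity one: the socle does not embed into `L₀/ϖL₀` modulo itself -/

/-- The intertwining operator `T : 𝓑(ψ₁, ψ₂) → 𝓑(ψ₂, ψ₁)` in Bruhat coordinates. [cite: EmertonGeeSavitt2015, §3.2] -/
def coordIntertwining (ψ₁ ψ₂ : (ZMod p)ˣ →* kˣ) :
    (coordRep ψ₁ ψ₂).IntertwiningMap (coordRep ψ₂ ψ₁) :=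
  (coordEquiv ψ₂ ψ₁).toIntertwiningMap.comp
    ((intertwiningMap ψ₁ ψ₂).comp (coordEquiv ψ₁ ψ₂).symm.toIntertwiningMap)

omit [CharP k p] in
/-- Unfolding. [cite: EmertonGeeSavitt2015, §3.2] -/
theorem coordIntertwining_apply (ψ₁ ψ₂ : (ZMod p)ˣ →* kˣ) (w : Option (ZMod p) → k) :
    coordIntertwining p ψ₁ ψ₂ w = bruhatEval ψ₂ ψ₁ (intertwining ψ₁ ψ₂ (bruhatLift ψ₁ ψ₂ w)) := rfl

/-- `T` in Bruhat coordinates, over the group ring `R[GL₂(𝔽_p)]` (restriction of scalars along `R → k`). [cite: EmertonGeeSavitt2015, §3.2] -/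
def coordIntertwiningLinear (ψ₁ ψ₂ : (ZMod p)ˣ →* kˣ) :
    (TwistedQuotient.resScalars R (coordRep ψ₁ ψ₂)).asModule →ₗ[MonoidAlgebra R (GL (Fin 2) (ZMod p))]
      (TwistedQuotient.resScalars R (coordRep ψ₂ ψ₁)).asModule :=
  Representation.IntertwiningMap.equivLinearMapAsModule _ _ ((coordIntertwining p ψ₁ ψ₂).resScalarsMap R)

omit [CharP k p] in
/-- Unfolding. [cite: EmertonGeeSavitt2015, §3.2] -/
theorem coordIntertwiningLinear_apply (ψ₁ ψ₂ : (ZMod p)ˣ →* kˣ)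
    (w : (TwistedQuotient.resScalars R (coordRep ψ₁ ψ₂)).asModule) :
    coordIntertwiningLinear p (R := R) ψ₁ ψ₂ w =
      (TwistedQuotient.resScalars R (coordRep ψ₂ ψ₁)).asModuleEquiv.symm
        (bruhatEval ψ₂ ψ₁ (intertwining ψ₁ ψ₂ (bruhatLift ψ₁ ψ₂
          ((TwistedQuotient.resScalars R (coordRep ψ₁ ψ₂)).asModuleEquiv w)))) := rfl

/-- Membership in the socle submodule, in coordinates: `q ∈ socle ↔ lift(reduction of q) ∈ Sym^r ⊗ χ̄₁∘det`. [cite: EmertonGeeSavitt2015, §3.2] -/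
theorem mem_modelSocle_iff {ϖ : R} (hker : ∀ a : R, algebraMap R k a = 0 ↔ ϖ ∣ a)
    (hsurj : Surjective (algebraMap R k))
    (hχ : ∀ a : (ZMod p)ˣ, (reduceChar k χ₂ a : k) = (reduceChar k χ₁ a : k) * ZMod.castHom (dvd_refl p) k a ^ r)
    (q : ↥(⊤ : Submodule (MonoidAlgebra R (GL (Fin 2) (ZMod p))) ρ₀.asModule) ⧸
        (ϖ • (⊤ : Submodule (MonoidAlgebra R (GL (Fin 2) (ZMod p))) ρ₀.asModule)).comap
          (⊤ : Submodule (MonoidAlgebra R (GL (Fin 2) (ZMod p))) ρ₀.asModule).subtype) :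
    q ∈ modelSocle p χ₁ χ₂ e₀ hker hsurj hχ ↔
      bruhatLift (reduceChar k χ₁) (reduceChar k χ₂)
          ((TwistedQuotient.resScalars R (coordRep (reduceChar k χ₁) (reduceChar k χ₂))).asModuleEquiv
            (modelReduceQuotEquiv χ₁ χ₂ e₀ hker hsurj q)) ∈
        symPowSubrep (ZMod.castHom (dvd_refl p) k) (reduceChar k χ₁) (reduceChar k χ₂) r hχ := by
  change ((TwistedQuotient.resScalars R (coordRep (reduceChar k χ₁) (reduceChar k χ₂))).asModuleEquiv
      (modelReduceQuotEquiv χ₁ χ₂ e₀ hker hsurj q)) ∈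
    Subrepresentation.mapEquiv (coordEquiv (reduceChar k χ₁) (reduceChar k χ₂))
      (symPowSubrep (ZMod.castHom (dvd_refl p) k) (reduceChar k χ₁) (reduceChar k χ₂) r hχ) ↔ _
  rw [Subrepresentation.mem_mapEquiv_iff]
  rfl

/-- The kernel of `T ∘ (reduction)` on `L₀/ϖL₀` is exactly the socle submodule (`ker T = Sym^r ⊗ χ̄₁∘det`). [cite: EmertonGeeSavitt2015, §3.2] -/
theorem ker_coordIntertwiningLinear_comp {ϖ : R} (hker : ∀ a : R, algebraMap R k a = 0 ↔ ϖ ∣ a)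
    (hsurj : Surjective (algebraMap R k)) (hχne : reduceChar k χ₁ ≠ reduceChar k χ₂)
    (hχ : ∀ a : (ZMod p)ˣ, (reduceChar k χ₂ a : k) = (reduceChar k χ₁ a : k) * ZMod.castHom (dvd_refl p) k a ^ r)
    (hrs : r + s = p - 1) :
    LinearMap.ker ((coordIntertwiningLinear p (reduceChar k χ₁) (reduceChar k χ₂)).comp
        (modelReduceQuotEquiv χ₁ χ₂ e₀ hker hsurj).toLinearMap) =
      modelSocle p χ₁ χ₂ e₀ hker hsurj hχ := by
  ext q
  rw [LinearMap.mem_ker, LinearMap.comp_apply, mem_modelSocle_iff, LinearEquiv.coe_toLinearMap,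
    coordIntertwiningLinear_apply, LinearEquiv.map_eq_zero_iff, ← bruhatEquiv_apply, LinearEquiv.map_eq_zero_iff,
    ← LinearMap.mem_ker, (ker_and_range_intertwining p hχne hχ hrs).1]
  rfl

/-- The values of `T` in coordinates lie in the coordinate image of `im T = Sym^s ⊗ χ̄₂∘det`. [cite: EmertonGeeSavitt2015, §3.2] -/
theorem coordIntertwiningLinear_mem (hχne : reduceChar k χ₁ ≠ reduceChar k χ₂)
    (hχ : ∀ a : (ZMod p)ˣ, (reduceChar k χ₂ a : k) = (reduceChar k χ₁ a : k) * ZMod.castHom (dvd_refl p) k a ^ r)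
    (hrs : r + s = p - 1)
    (w : (TwistedQuotient.resScalars R (coordRep (reduceChar k χ₁) (reduceChar k χ₂))).asModule) :
    (TwistedQuotient.resScalars R (coordRep (reduceChar k χ₂) (reduceChar k χ₁))).asModuleEquiv
        (coordIntertwiningLinear p (reduceChar k χ₁) (reduceChar k χ₂) w) ∈
      Subrepresentation.mapEquiv (coordEquiv (reduceChar k χ₂) (reduceChar k χ₁))
        (symPowSubrep (ZMod.castHom (dvd_refl p) k) (reduceChar k χ₂) (reduceChar k χ₁) s
          (rel_symm p hχ hrs)) := by
  rw [Subrepresentation.mem_mapEquiv_iff, coordIntertwiningLinear_apply, LinearEquiv.apply_symm_apply,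
    coordEquiv_symm_apply, bruhatLift_bruhatEval]
  change intertwining _ _ _ ∈ (symPowSubrep (ZMod.castHom (dvd_refl p) k) (reduceChar k χ₂) (reduceChar k χ₁) s
    (rel_symm p hχ hrs)).toSubmodule
  rw [← (ker_and_range_intertwining p hχne hχ hrs).2]
  exact LinearMap.mem_range_self _ _

omit [CharP k p] in
/-- Irreducibility of the coordinate image of an irreducible subrepresentation. [cite: EmertonGeeSavitt2015, §3.2] -/
theorem isIrreducible_mapEquiv {W₁ W₂ : Type} [AddCommGroup W₁] [Module k W₁] [AddCommGroup W₂] [Module k W₂]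
    {τ₁ : Representation k (GL (Fin 2) (ZMod p)) W₁} {τ₂ : Representation k (GL (Fin 2) (ZMod p)) W₂}
    (e : τ₁.Equiv τ₂) (X : Subrepresentation τ₁)
    (hX : Representation.IsIrreducible (V := X.toSubmodule) X.toRepresentation) :
    Representation.IsIrreducible (V := (Subrepresentation.mapEquiv e X).toSubmodule)
      (Subrepresentation.mapEquiv e X).toRepresentation :=
  (Representation.isIrreducible_iff_of_equivariant X.toRepresentation (Subrepresentation.mapEquiv e X).toRepresentation
    (MonoidHom.id _) Function.surjective_id (Subrepresentation.equivMapEquiv e X).toLinearEquiv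
    (fun g x => (Subrepresentation.equivMapEquiv e X).apply_apply_eq g x)).mp hX

/-- **The hard case of multiplicity one**: the socle `S` of `L₀/ϖL₀` admits no injective group-ring-linear map
into `(L₀/ϖL₀)/S` — such a map, followed by `T` (which kills exactly `S`), would be an injective intertwining map
`Sym^r ⊗ χ̄₁∘det → im T = Sym^s ⊗ χ̄₂∘det` between the two non-isomorphic irreducible Jordan–Hölder factors. [cite: EmertonGeeSavitt2015, §3.2] -/
theorem not_socle_embeds_quotient {ϖ : R} (hker : ∀ a : R, algebraMap R k a = 0 ↔ ϖ ∣ a)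
    (hsurj : Surjective (algebraMap R k)) (hχne : reduceChar k χ₁ ≠ reduceChar k χ₂)
    (hχ : ∀ a : (ZMod p)ˣ, (reduceChar k χ₂ a : k) = (reduceChar k χ₁ a : k) * ZMod.castHom (dvd_refl p) k a ^ r)
    (hrs : r + s = p - 1)
    (g : ↥(modelSocle p χ₁ χ₂ e₀ hker hsurj hχ) →ₗ[MonoidAlgebra R (GL (Fin 2) (ZMod p))]
      ((↥(⊤ : Submodule (MonoidAlgebra R (GL (Fin 2) (ZMod p))) ρ₀.asModule) ⧸
        (ϖ • (⊤ : Submodule (MonoidAlgebra R (GL (Fin 2) (ZMod p))) ρ₀.asModule)).comap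
          (⊤ : Submodule (MonoidAlgebra R (GL (Fin 2) (ZMod p))) ρ₀.asModule).subtype) ⧸
        modelSocle p χ₁ χ₂ e₀ hker hsurj hχ))
    (hgi : Injective g) : False := by
  have hp : 2 ≤ p := (Fact.out : p.Prime).two_le
  have hr : r < p := by omega
  have hs : s < p := by omega
  have hr' : r < Fintype.card (ZMod p) := by rwa [ZMod.card]
  -- `θ = T ∘ red`, kernel = socle; `θbar` its injective factorisation through the quotient by the socle
  have hkerθ := ker_coordIntertwiningLinear_comp p χ₁ χ₂ e₀ hker hsurj hχne hχ hrs
  have hθbar_inj : Injective ((modelSocle p χ₁ χ₂ e₀ hker hsurj hχ).liftQ _ (le_of_eq hkerθ.symm)) := by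
    rw [← LinearMap.ker_eq_bot]
    exact Submodule.ker_liftQ_eq_bot' _ _ hkerθ.symm
  have hθbar_mem : ∀ y, (TwistedQuotient.resScalars R (coordRep (reduceChar k χ₂) (reduceChar k χ₁))).asModuleEquiv
      ((modelSocle p χ₁ χ₂ e₀ hker hsurj hχ).liftQ _ (le_of_eq hkerθ.symm) y) ∈
        Subrepresentation.mapEquiv (coordEquiv (reduceChar k χ₂) (reduceChar k χ₁))
          (symPowSubrep (ZMod.castHom (dvd_refl p) k) (reduceChar k χ₂) (reduceChar k χ₁) s
            (rel_symm p hχ hrs)) := by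
    intro y
    obtain ⟨q, rfl⟩ := Submodule.Quotient.mk_surjective _ y
    rw [Submodule.liftQ_apply, LinearMap.comp_apply]
    exact coordIntertwiningLinear_mem p χ₁ χ₂ hχne hχ hrs _
  -- the socle submodule is carried by `red` onto the group-ring submodule `S₁` attached to `X₀ = coord(Sym^r ⊗ χ̄₁∘det)`
  have hS₁ : (modelSocle p χ₁ χ₂ e₀ hker hsurj hχ).map
      (modelReduceQuotEquiv χ₁ χ₂ e₀ hker hsurj : _ →ₗ[MonoidAlgebra R (GL (Fin 2) (ZMod p))] _) =
      Subrepresentation.asSubmodule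
        ((subrepResScalarsOrderIso (coordRep (reduceChar k χ₁) (reduceChar k χ₂)) hsurj).symm
          (Subrepresentation.mapEquiv (coordEquiv (reduceChar k χ₁) (reduceChar k χ₂))
            (symPowSubrep (ZMod.castHom (dvd_refl p) k) (reduceChar k χ₁) (reduceChar k χ₂) r hχ))) :=
    Submodule.map_comap_eq_of_surjective (modelReduceQuotEquiv χ₁ χ₂ e₀ hker hsurj).surjective _
  let ι := (((modelReduceQuotEquiv χ₁ χ₂ e₀ hker hsurj).submoduleMap
    (modelSocle p χ₁ χ₂ e₀ hker hsurj hχ)).trans (LinearEquiv.ofEq _ _ hS₁)).symm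
  -- the composite `S₁ ≅ S ↪ Q/S ↪ coordRep(χ̄₂, χ̄₁)` over the group ring ...
  let h := (((modelSocle p χ₁ χ₂ e₀ hker hsurj hχ).liftQ _ (le_of_eq hkerθ.symm)).comp g).comp ι.toLinearMap
  have hh_inj : Injective h := (hθbar_inj.comp hgi).comp ι.injective
  -- ... is an injective intertwining map `X₀ → coordRep(χ̄₂, χ̄₁)` over `k`, with values in `Y₀ = coord(im T)`
  let ψ := intertwiningMapOfLinearMap (coordRep (reduceChar k χ₁) (reduceChar k χ₂))
    (coordRep (reduceChar k χ₂) (reduceChar k χ₁)) hsurj _ h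
  have hψ_inj : Injective ψ := intertwiningMapOfLinearMap_injective _ _ hsurj _ h hh_inj
  have hψY : ∀ v, ψ v ∈ Subrepresentation.mapEquiv (coordEquiv (reduceChar k χ₂) (reduceChar k χ₁))
      (symPowSubrep (ZMod.castHom (dvd_refl p) k) (reduceChar k χ₂) (reduceChar k χ₁) s (rel_symm p hχ hrs)) :=
    fun v => hθbar_mem _
  let ψY := ψ.codRestrictSub _ hψY
  have hψY_inj : Injective ψY := fun a b hab => hψ_inj (congrArg Subtype.val hab)
  -- both ends are irreducible, hence `ψY` is bijective or zero
  haveI := isIrreducible_mapEquiv p (coordEquiv (reduceChar k χ₁) (reduceChar k χ₂)) _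
    (isIrreducible_symPowSubrep p hχ hr)
  haveI := isIrreducible_mapEquiv p (coordEquiv (reduceChar k χ₂) (reduceChar k χ₁)) _
    (isIrreducible_symPowSubrep p (rel_symm p hχ hrs) hs)
  rcases Representation.IsIrreducible.bijective_or_eq_zero ψY with hbij | hzero
  · -- an isomorphism `X ≅ X₀ ≅ Y₀ ≅ Y` of the two Jordan–Hölder factors: impossible
    exact (isEmpty_equiv_socle_cosocle p hχne hχ hrs).false
      (((Subrepresentation.equivMapEquiv _ _).trans (ψY.ofBijective hbij)).trans
        (Subrepresentation.equivMapEquiv _ _).symm)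
  · -- `ψY = 0` contradicts injectivity on the nonzero `X₀`
    have hX₀ : (Subrepresentation.mapEquiv (coordEquiv (reduceChar k χ₁) (reduceChar k χ₂))
        (symPowSubrep (ZMod.castHom (dvd_refl p) k) (reduceChar k χ₁) (reduceChar k χ₂) r hχ)).toSubmodule ≠ ⊥ := by
      intro hb
      apply symPowSubrep_ne_bot hχ hr'
      have hb' : Subrepresentation.mapEquiv (coordEquiv (reduceChar k χ₁) (reduceChar k χ₂))
          (symPowSubrep (ZMod.castHom (dvd_refl p) k) (reduceChar k χ₁) (reduceChar k χ₂) r hχ) = ⊥ :=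
        Subrepresentation.toSubmodule_injective hb
      have := congrArg (Subrepresentation.mapEquiv (coordEquiv (reduceChar k χ₁) (reduceChar k χ₂))).symm hb'
      rwa [OrderIso.symm_apply_apply, OrderIso.map_bot] at this
    obtain ⟨x₀, hx₀X, hx₀0⟩ := Submodule.exists_mem_ne_zero_of_ne_bot hX₀
    have h1 : ψY ⟨x₀, hx₀X⟩ = ψY 0 := by rw [hzero]; rfl
    exact hx₀0 (congrArg Subtype.val (hψY_inj h1))

/-- **Multiplicity one**: the socle `S` of `L₀/ϖL₀` does not embed over the group ring simultaneously into a
submodule `N` and into the quotient `(L₀/ϖL₀)/N` (`χ̄₁ ≠ χ̄₂ = χ̄₁ε^r`, `r + s = p − 1`): by uniseriality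
`N ∈ {0, S, ⊤}`; `N = 0` and `N = ⊤` leave no room, `N = S` is `not_socle_embeds_quotient`. [cite: EmertonGeeSavitt2015, §3.2] -/
theorem not_socle_embeds_twice {ϖ : R} (hker : ∀ a : R, algebraMap R k a = 0 ↔ ϖ ∣ a)
    (hsurj : Surjective (algebraMap R k)) (hχne : reduceChar k χ₁ ≠ reduceChar k χ₂)
    (hχ : ∀ a : (ZMod p)ˣ, (reduceChar k χ₂ a : k) = (reduceChar k χ₁ a : k) * ZMod.castHom (dvd_refl p) k a ^ r)
    (hrs : r + s = p - 1)
    (N : Submodule (MonoidAlgebra R (GL (Fin 2) (ZMod p)))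
      (↥(⊤ : Submodule (MonoidAlgebra R (GL (Fin 2) (ZMod p))) ρ₀.asModule) ⧸
        (ϖ • (⊤ : Submodule (MonoidAlgebra R (GL (Fin 2) (ZMod p))) ρ₀.asModule)).comap
          (⊤ : Submodule (MonoidAlgebra R (GL (Fin 2) (ZMod p))) ρ₀.asModule).subtype))
    (hf : ∃ f : ↥(modelSocle p χ₁ χ₂ e₀ hker hsurj hχ) →ₗ[MonoidAlgebra R (GL (Fin 2) (ZMod p))] ↥N,
      Injective f)
    (hg : ∃ g : ↥(modelSocle p χ₁ χ₂ e₀ hker hsurj hχ) →ₗ[MonoidAlgebra R (GL (Fin 2) (ZMod p))]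
      ((↥(⊤ : Submodule (MonoidAlgebra R (GL (Fin 2) (ZMod p))) ρ₀.asModule) ⧸
        (ϖ • (⊤ : Submodule (MonoidAlgebra R (GL (Fin 2) (ZMod p))) ρ₀.asModule)).comap
          (⊤ : Submodule (MonoidAlgebra R (GL (Fin 2) (ZMod p))) ρ₀.asModule).subtype) ⧸ N),
      Injective g) : False := by
  have hp : 2 ≤ p := (Fact.out : p.Prime).two_le
  have hr : r < p := by omega
  obtain ⟨x, hxS, hx0⟩ := Submodule.exists_mem_ne_zero_of_ne_bot (modelSocle_ne_bot p χ₁ χ₂ e₀ hker hsurj hχ hr)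
  rcases eq_bot_or_eq_modelSocle_or_eq_top p χ₁ χ₂ e₀ hker hsurj hχne hχ hrs N with hN | hN | hN
  · -- `N = 0`: no injection from the nonzero socle
    obtain ⟨f, hfi⟩ := hf
    subst hN
    have : f ⟨x, hxS⟩ = f 0 := Subsingleton.elim _ _
    exact hx0 (congrArg Subtype.val (hfi this))
  · obtain ⟨g, hgi⟩ := hg
    subst hN
    exact not_socle_embeds_quotient p χ₁ χ₂ e₀ hker hsurj hχne hχ hrs g hgi
  · -- `N = ⊤`: no injection into the zero quotient
    obtain ⟨g, hgi⟩ := hg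
    subst hN
    have : g ⟨x, hxS⟩ = g 0 := Subsingleton.elim _ _
    exact hx0 (congrArg Subtype.val (hgi this))

end Socle

end GL2

end Literature.RepresentationTheory.FiniteGroups
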